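import Mathlib.Analysis.SpecialFunctions.Sqrt
import Mathlib.Analysis.Calculus.Deriv.Add
import Mathlib.Analysis.Calculus.Deriv.Mul
import Mathlib.Analysis.Calculus.Deriv.Inv
import Mathlib.Analysis.Calculus.Deriv.Pow
import Mathlib.Tactic.FieldSimp
import Mathlib.Tactic.Linarith
import Mathlib.Tactic.Positivity

/-!
# Crux `PerpetualPump.AveragedTypeIBlowup` (stmt-NavierStokesRegularity-1835), line `Sketch`:
# stub `gateAlgebra` — pointwise calculus of the forced Toda gate

This file proves the registered stub `stub_gateAlgebra` of the line skeleton
`Cruxes/AveragedTypeIBlowup/Lines/Sketch.lean` (G3a, Mathlib-only). During the TRANSFER PULSE of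
the seeded graded Toda circuit the three active amplitudes (carrier `b`, bond `w`, next carrier
`β = b_{n+1}/q`, in critical units and slow time) obey
`b' = -b - w² + f₁`, `w' = w (b - β - 1) + f₂`, `β' = -q⁴ β + w² + f₃`
with forcings `f₁ f₂ f₃`. The pulse is analysed in the coordinates `P = b + β`, `D = b - β`,
`R = √(D² + 2w²)`, `u = D / R`, `J = 2bβ - w²` (inviscid gate: `P, R, J` decay conformally,
`u' = -R(1 - u²)` is a logistic clock). Given the three `HasDerivAt` hypotheses at ONE point `σ`
(the forcings are real numbers there) and `0 < w σ` (so `R > 0`), we produce: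
* `P' = -P - (q⁴ - 1)β + f₁ + f₃` and
  `J' = -(1 + q⁴)J + (1 - q⁴)w² + 2βf₁ + 2bf₃ - 2wf₂` (sum / product rules + `ring`);
* the exact radius law `R' = (N - R²)/R`, `N = D g₁ + 2 w f₂`, `g₁ = (q⁴ - 1)β + f₁ - f₃`
  (chain rule through `Real.sqrt`), whence `|R' + R| = |N| / R ≤ |g₁| + √2 |f₂|` from `|D| ≤ R`,
  `2w ≤ √2 R`;
* the quotient rule for `u = D/R` and the LOGISTIC CLOCK inequality
  `u' ≤ -(R - |g₁|/R)(1 - u²) + √2 |f₂| / R`: after clearing denominators (`R² = D² + 2w²`) it is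
  `2w²(|g₁| - g₁) + √2|f₂|R² + 2Dwf₂ ≥ 0`, i.e. `|2 D w f₂| ≤ √2 |f₂| R²`.
All algebra is kept in small real-variable lemmas (`gateAlgebra_radius_bound`,
`gateAlgebra_slope_bound`); the derivative values for `R` and `u` are the ones delivered by
`HasDerivAt.sqrt` / `HasDerivAt.fun_div`, rewritten by pure field identities.

## References

* T. Tao, *Finite time blowup for an averaged three-dimensional Navier–Stokes equation*, J. Amer.
  Math. Soc. 29 (2016), 601–674, §5.4–5.5 (the Toda-type transfer gate; the computations here are
  folklore calculus).
-/

noncomputable section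

-- the summit namespace `…NavierStokesRegularity.NavierStokesRegularity…` is the tree convention
set_option linter.dupNamespace false

open Set Filter Topology

namespace Summit.NavierStokesRegularity.NavierStokesRegularity.Theorems.PerpetualPumpAveragedTypeIBlowup

/-- Derivative of the square of a real function: `(f²)' = 2 f f'` (the `n = 2` case of
`HasDerivAt.fun_pow`, with the exponent arithmetic normalised). [folklore] -/
theorem gateAlgebra_hasDerivAt_sq {f : ℝ → ℝ} {f' x : ℝ} (hf : HasDerivAt f f' x) :
    HasDerivAt (fun s => f s ^ 2) (2 * f x * f') x := by
  simpa using hf.fun_pow 2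

/-- **Radius facts.** With `0 < W` and `R = √(D² + 2W²)`: `0 < R`, `R² = D² + 2W²`, `|D| ≤ R` and
`2W ≤ √2 R`. [folklore] -/
theorem gateAlgebra_radius_facts {D W R : ℝ} (hW : 0 < W) (hR : Real.sqrt (D ^ 2 + 2 * W ^ 2) = R) :
    0 < R ∧ R ^ 2 = D ^ 2 + 2 * W ^ 2 ∧ |D| ≤ R ∧ 2 * W ≤ Real.sqrt 2 * R := by
  have hQ0 : 0 < D ^ 2 + 2 * W ^ 2 :=
    add_pos_of_nonneg_of_pos (sq_nonneg D) (mul_pos two_pos (pow_pos hW 2))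
  have hR0 : 0 < R := by rw [← hR]; exact Real.sqrt_pos.2 hQ0
  have hR2 : R ^ 2 = D ^ 2 + 2 * W ^ 2 := by rw [← hR]; exact Real.sq_sqrt hQ0.le
  have h2 : Real.sqrt 2 ^ 2 = 2 := Real.sq_sqrt zero_le_two
  have hDR : |D| ≤ R := abs_le_of_sq_le_sq (by nlinarith [sq_nonneg W]) hR0.le
  have hWR' : |2 * W| ≤ Real.sqrt 2 * R := by
    refine abs_le_of_sq_le_sq ?_ (mul_nonneg (Real.sqrt_nonneg 2) hR0.le)
    rw [mul_pow, mul_pow, h2, hR2]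
    nlinarith [sq_nonneg D]
  exact ⟨hR0, hR2, hDR, (abs_le.1 hWR').2⟩

/-- **Radius tracking bound.** With `0 < W`, `R = √(D² + 2W²)` and `N = D g + 2 W f`, the exact
radius law `R' = (N - (D² + 2W²))/R` of the forced gate gives
`|R' + R| = |N|/R ≤ |g| + √2 |f|` (from `|D| ≤ R`, `2W ≤ √2 R`). [folklore] -/
theorem gateAlgebra_radius_bound {D W g f R : ℝ} (hW : 0 < W)
    (hR : Real.sqrt (D ^ 2 + 2 * W ^ 2) = R) :
    |(D * g + 2 * W * f - (D ^ 2 + 2 * W ^ 2)) / R + R| ≤ |g| + Real.sqrt 2 * |f| := by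
  obtain ⟨hR0, hR2, hDR, hWR⟩ := gateAlgebra_radius_facts hW hR
  have hRne : R ≠ 0 := hR0.ne'
  have e : (D * g + 2 * W * f - (D ^ 2 + 2 * W ^ 2)) / R + R = (D * g + 2 * W * f) / R := by
    rw [← hR2]
    field_simp
    ring
  rw [e, abs_div, abs_of_pos hR0, div_le_iff₀ hR0]
  calc |D * g + 2 * W * f| ≤ |D * g| + |2 * W * f| := abs_add_le _ _
    _ = |D| * |g| + 2 * W * |f| := by
        rw [abs_mul, abs_mul, abs_mul, abs_two, abs_of_pos hW]
    _ ≤ R * |g| + Real.sqrt 2 * R * |f| :=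
        add_le_add (mul_le_mul_of_nonneg_right hDR (abs_nonneg g))
          (mul_le_mul_of_nonneg_right hWR (abs_nonneg f))
    _ = (|g| + Real.sqrt 2 * |f|) * R := by ring

/-- **Logistic clock bound.** With `0 < W`, `R = √(D² + 2W²)`, `N = D g + 2 W f`, the quotient-rule
value `u' = (D' R - D R')/R²` of `u = D/R` (where `D' = -D - 2W² + g`, `R' = (N - (D² + 2W²))/R`)
satisfies `u' ≤ -(R - |g|/R)(1 - (D/R)²) + √2 |f| / R`: after clearing denominators with
`R² = D² + 2W²` this is `0 ≤ 2W²(|g| - g) + √2 |f| R² + 2 D W f`, and `|2 D W f| ≤ √2 |f| R²`.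
[folklore] -/
theorem gateAlgebra_slope_bound {D W g f R : ℝ} (hW : 0 < W)
    (hR : Real.sqrt (D ^ 2 + 2 * W ^ 2) = R) :
    ((-D - 2 * W ^ 2 + g) * R - D * ((D * g + 2 * W * f - (D ^ 2 + 2 * W ^ 2)) / R)) / R ^ 2 ≤
      -(R - |g| / R) * (1 - (D / R) ^ 2) + Real.sqrt 2 * |f| / R := by
  obtain ⟨hR0, hR2, hDR, hWR⟩ := gateAlgebra_radius_facts hW hR
  have hRne : R ≠ 0 := hR0.ne'
  have key : |2 * D * W * f| ≤ Real.sqrt 2 * |f| * R ^ 2 :=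
    calc |2 * D * W * f| = 2 * W * |D| * |f| := by
          rw [abs_mul, abs_mul, abs_mul, abs_two, abs_of_pos hW]; ring
      _ ≤ Real.sqrt 2 * R * R * |f| :=
          mul_le_mul_of_nonneg_right
            (mul_le_mul hWR hDR (abs_nonneg D) (mul_nonneg (Real.sqrt_nonneg 2) hR0.le))
            (abs_nonneg f)
      _ = Real.sqrt 2 * |f| * R ^ 2 := by ring
  have hU : ((-D - 2 * W ^ 2 + g) * R - D * ((D * g + 2 * W * f - (D ^ 2 + 2 * W ^ 2)) / R)) /
        R ^ 2 =
      ((-D - 2 * W ^ 2 + g) * R ^ 2 - D * (D * g + 2 * W * f - (D ^ 2 + 2 * W ^ 2))) / R ^ 3 := by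
    field_simp
  have hT : -(R - |g| / R) * (1 - (D / R) ^ 2) + Real.sqrt 2 * |f| / R =
      (-(R ^ 2 - |g|) * (R ^ 2 - D ^ 2) + Real.sqrt 2 * |f| * R ^ 2) / R ^ 3 := by
    field_simp
  rw [hU, hT]
  refine div_le_div_of_nonneg_right ?_ (pow_nonneg hR0.le 3)
  rw [hR2] at key ⊢
  have F1 : W ^ 2 * g ≤ W ^ 2 * |g| := mul_le_mul_of_nonneg_left (le_abs_self g) (sq_nonneg W)
  nlinarith [key, F1, neg_abs_le (2 * D * W * f)]

/-- **The exact radius law of the forced Toda gate.** With `b' = -b - w² + f₁`,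
`w' = w(b - β - 1) + f₂`, `β' = -q⁴β + w² + f₃` at `σ` and `R = √((b - β)² + 2w²) > 0`, the radius
`s ↦ √((b s - β s)² + 2 (w s)²)` has derivative `(N - ((b - β)² + 2w²))/R` at `σ`, where
`N = (b - β)((q⁴ - 1)β + f₁ - f₃) + 2 w f₂` (chain rule: `(R²)' = 2DD' + 4ww' = -2R² + 2N`).
[folklore] -/
theorem gateAlgebra_radius_hasDerivAt {b w β : ℝ → ℝ} {q4 f₁ f₂ f₃ σ R : ℝ}
    (hb : HasDerivAt b (-(b σ) - (w σ) ^ 2 + f₁) σ)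
    (hw : HasDerivAt w (w σ * (b σ - β σ - 1) + f₂) σ)
    (hβ : HasDerivAt β (-(q4 * β σ) + (w σ) ^ 2 + f₃) σ)
    (hR : Real.sqrt ((b σ - β σ) ^ 2 + 2 * (w σ) ^ 2) = R) (hR0 : 0 < R) :
    HasDerivAt (fun s => Real.sqrt ((b s - β s) ^ 2 + 2 * (w s) ^ 2))
      (((b σ - β σ) * ((q4 - 1) * β σ + f₁ - f₃) + 2 * w σ * f₂ -
          ((b σ - β σ) ^ 2 + 2 * (w σ) ^ 2)) / R) σ := by
  have hQ0 : 0 < (b σ - β σ) ^ 2 + 2 * (w σ) ^ 2 := Real.sqrt_pos.mp (hR ▸ hR0)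
  have hRne : R ≠ 0 := hR0.ne'
  have h := ((gateAlgebra_hasDerivAt_sq (hb.fun_sub hβ)).fun_add
    ((gateAlgebra_hasDerivAt_sq hw).const_mul 2)).sqrt hQ0.ne'
  rw [hR] at h
  refine h.congr_deriv ?_
  field_simp
  ring

/-- **Stub `gateAlgebra`** (G3a, Mathlib-only) of line `Sketch`, crux `PerpetualPump.AveragedTypeIBlowup`.
Pointwise calculus of the FORCED TODA GATE in slow time:
`b' = −b − w² + f₁`, `w' = w(b − β − 1) + f₂`, `β' = −q⁴β + w² + f₃` (carrier, bond, next carrier/q).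
With `D = b − β`, `P = b + β`, `R = (D² + 2w²)^{1/2}`, `u = D/R`, `J = 2bβ − w²`:
`P' = −P − (q⁴−1)β + f₁ + f₃`; `J' = −(1+q⁴)J + (1−q⁴)w² + 2βf₁ + 2bf₃ − 2wf₂`;
`|R' + R| ≤ |g₁| + √2|f₂|` and the LOGISTIC CLOCK `u' ≤ −(R − |g₁|/R)(1 − u²) + √2|f₂|/R`,
`g₁ = (q⁴−1)β + f₁ − f₃`. [folklore] -/
theorem stub_gateAlgebra :
    ∀ (b w β : ℝ → ℝ) (q4 f₁ f₂ f₃ σ : ℝ),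
      HasDerivAt b (-(b σ) - (w σ) ^ 2 + f₁) σ →
      HasDerivAt w (w σ * (b σ - β σ - 1) + f₂) σ →
      HasDerivAt β (-(q4 * β σ) + (w σ) ^ 2 + f₃) σ →
      0 < w σ →
      HasDerivAt (fun s => b s + β s) (-(b σ + β σ) - (q4 - 1) * β σ + f₁ + f₃) σ ∧
      HasDerivAt (fun s => 2 * b s * β s - (w s) ^ 2)
        (-(1 + q4) * (2 * b σ * β σ - (w σ) ^ 2) + (1 - q4) * (w σ) ^ 2 +
          2 * β σ * f₁ + 2 * b σ * f₃ - 2 * w σ * f₂) σ ∧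
      (∃ R' : ℝ, HasDerivAt (fun s => Real.sqrt ((b s - β s) ^ 2 + 2 * (w s) ^ 2)) R' σ ∧
        |R' + Real.sqrt ((b σ - β σ) ^ 2 + 2 * (w σ) ^ 2)| ≤
          |(q4 - 1) * β σ + f₁ - f₃| + Real.sqrt 2 * |f₂|) ∧
      (∃ u' : ℝ, HasDerivAt (fun s => (b s - β s) / Real.sqrt ((b s - β s) ^ 2 + 2 * (w s) ^ 2)) u' σ ∧
        u' ≤ -(Real.sqrt ((b σ - β σ) ^ 2 + 2 * (w σ) ^ 2) -
              |(q4 - 1) * β σ + f₁ - f₃| / Real.sqrt ((b σ - β σ) ^ 2 + 2 * (w σ) ^ 2)) *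
            (1 - ((b σ - β σ) / Real.sqrt ((b σ - β σ) ^ 2 + 2 * (w σ) ^ 2)) ^ 2) +
          Real.sqrt 2 * |f₂| / Real.sqrt ((b σ - β σ) ^ 2 + 2 * (w σ) ^ 2)) := by
  intro b w β q4 f₁ f₂ f₃ σ hb hw hβ hwpos
  obtain ⟨R, hR⟩ : ∃ R, Real.sqrt ((b σ - β σ) ^ 2 + 2 * (w σ) ^ 2) = R := ⟨_, rfl⟩
  obtain ⟨hR0, -, -, -⟩ := gateAlgebra_radius_facts hwpos hR
  have hRne : Real.sqrt ((b σ - β σ) ^ 2 + 2 * (w σ) ^ 2) ≠ 0 := by rw [hR]; exact hR0.ne'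
  have hRad := gateAlgebra_radius_hasDerivAt hb hw hβ hR hR0
  have hU := (hb.fun_sub hβ).fun_div hRad hRne
  rw [hR]
  refine ⟨(hb.fun_add hβ).congr_deriv (by ring), ?_, ⟨_, hRad, gateAlgebra_radius_bound hwpos hR⟩,
    ⟨_, hU.congr_deriv ?_,
      gateAlgebra_slope_bound (g := (q4 - 1) * β σ + f₁ - f₃) (f := f₂) hwpos hR⟩⟩
  · exact (((hb.const_mul 2).fun_mul hβ).fun_sub (gateAlgebra_hasDerivAt_sq hw)).congr_deriv
      (by ring)
  · simp only [hR]
    ring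

end Summit.NavierStokesRegularity.NavierStokesRegularity.Theorems.PerpetualPumpAveragedTypeIBlowup

end
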